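import Mathlib.RepresentationTheory.Homological.GroupCohomology.Hilbert90
import Mathlib.FieldTheory.Galois.Basic
import Literature.GroupTheory.Index.HerbrandLemma
import HarnessLib

/-!
# The norm index of a cyclic extension: Hilbert 90 and the Herbrand-quotient reduction (Neukirch ANT IV §3, §7)

Pure algebra behind the **class field axiom** (Neukirch, *Algebraic Number Theory*, Ch. IV (6.1),
Ch. V Thm. (1.1); `LocalClassFieldAxiom.lean` for the local-field input).  Let `L/K` be a finite
Galois extension of fields whose group `G = Gal(L/K)` is cyclic, generated by `σ`, `n = #G = [L:K]`.
On the abelian group `Lˣ` we consider Neukirch's two endomorphisms (Ch. IV §7, p. 310 of the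
translation: `N_G a = ∏_{i<n} a^{σ^i}`, `a^{σ-1}`)

* `Literature.NumberTheory.GaloisRepresentations.CyclicNormIndex.normEnd σ n : Lˣ →* Lˣ`,
  `u ↦ ∏_{i<n} σ^i u` — for `n = #G` this is `N_{L/K}` followed by `Kˣ → Lˣ`
  (`coe_normEnd_eq_algebraMap_norm`, Mathlib `Algebra.norm_eq_prod_automorphisms`);
* `Literature.NumberTheory.GaloisRepresentations.CyclicNormIndex.twistEnd σ : Lˣ →* Lˣ`, `u ↦ σu/u`,

so that `H⁰(G, Lˣ) = ker T / im N = Kˣ/N Lˣ` and `H⁻¹(G, Lˣ) = ker N / im T` (`ker_twistEnd`: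
`ker T = Kˣ` is Galois theory, `range_normEnd`).  We prove:

* `exists_smul_div_eq_of_normEnd_eq_one`, `ker_normEnd_le_range_twistEnd` — **Hilbert 90**
  (Neukirch IV (3.5): `H⁻¹(G, Lˣ) = 1`, an element of norm `1` is `σb/b`), deduced as in Neukirch
  IV (3.7) from Noether's form (Mathlib `groupCohomology.isMulCoboundary₁_of_isMulCocycle₁_of_aut_to_units`,
  universe-polymorphic; Mathlib's own cyclic corollary `groupCohomology.exists_div_of_norm_eq_one`
  is stated for `K L : Type` only) via the `1`-cocycle `σ^k ↦ ∏_{i<k} σ^i a`;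
* `index_range_norm_eq_card` — the **reduction of `#H⁰(G, Lˣ) = [L:K]` to a cohomologically
  trivial subgroup**: if `V ≤ Lˣ` is `σ`-stable with `H⁰(G, V) = H⁻¹(G, V) = 1` (every `σ`-fixed
  element of `V` is a norm from `V`, every norm-one element of `V` is `σw/w` with `w ∈ V`), and
  `c ∈ Kˣ` has `c^k ∈ V ⇒ k = 0` and `(Lˣ : V·c^ℤ) < ∞`, then `(Kˣ : N_{L/K} Lˣ) = #G`.  This is the
  content of Neukirch's computation `h(G, Lˣ) = h(G, ℤ)·h(G, U_L) = [L:K]·h(U_L/Vⁿ)·h(Vⁿ) = [L:K]`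
  (IV (7.3), V (1.1)), organised through the tree's index form of the Herbrand quotient
  (`Literature.GroupTheory.Index.herbrandLemma`, O'Meara 65:9: the quotient is unchanged on a
  finite-index subgroup `Φ`), with `Φ = V·c^ℤ`, for which `(Φ ∩ ker T : NΦ) = #G` and
  `(Φ ∩ ker N : TΦ) = 1` are computed directly (`relIndex_map_normEnd_eq_card`,
  `inf_ker_normEnd_le_map_twistEnd`).

For a local field `K`, `V = 1 + π^t 𝒪_K[G]·α` (`α` a normal basis generator) and `c = π`
satisfy the hypotheses; that is `LocalClassFieldAxiom.lean`.

## References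

* J. Neukirch, *Algebraic Number Theory*, Grundlehren 322, Springer 1999 (transl. Schappacher):
  Ch. IV §3 Thm. (3.5), Prop. (3.7), (3.8); Ch. IV §6 Axiom (6.1); Ch. IV §7 (7.1)–(7.3);
  Ch. V §1 Thm. (1.1).  [NeukirchANT1999]
* O. T. O'Meara, *Introduction to quadratic forms* (1963), §65B, 65:9.  [Omeara1963]

## Mathlib

`groupCohomology.isMulCoboundary₁_of_isMulCocycle₁_of_aut_to_units` (Noether's Hilbert 90),
`Algebra.norm_eq_prod_automorphisms`, `IsGalois.mem_bot_iff_fixed`, `IsGalois.card_aut_eq_finrank`,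
`orderOf_eq_card_of_forall_mem_zpowers`, `pow_eq_pow_iff_modEq`, `Subgroup.relIndex_map_map_of_injective`;
the tree's `Literature.GroupTheory.Index.herbrandLemma`.  Mathlib has no Herbrand quotient / Tate
cohomology index computations for `Lˣ` at this pin.
-/

namespace Literature.NumberTheory.GaloisRepresentations

namespace CyclicNormIndex

open scoped Pointwise

variable {K L : Type*} [Field K] [Field L] [Algebra K L]

/-! ### The endomorphisms `N = ∏ σ^i` and `T = σ - 1` of `Lˣ` -/

/-- The inclusion `Kˣ → Lˣ`. [folklore] -/
abbrev unitsIncl (K L : Type*) [Field K] [Field L] [Algebra K L] : Kˣ →* Lˣ :=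
  Units.map (algebraMap K L : K →+* L).toMonoidHom

/-- `Kˣ → Lˣ` on values is `algebraMap`. [folklore] -/
@[simp] theorem coe_unitsIncl (c : Kˣ) : ((unitsIncl K L c : Lˣ) : L) = algebraMap K L c := rfl

/-- `Kˣ → Lˣ` is injective. [folklore] -/
theorem unitsIncl_injective : Function.Injective (unitsIncl K L) :=
  Units.map_injective (algebraMap K L).injective

/-- Neukirch's `a ↦ a^{σ-1} = σa/a` on `Lˣ` (`I_G A = {a^{σ-1}}`, `A^G = ker`).
[cite: NeukirchANT1999, Ch. IV §7 (p. 310)] -/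
noncomputable def twistEnd (σ : L ≃ₐ[K] L) : Lˣ →* Lˣ :=
  MulDistribMulAction.toMonoidHom Lˣ σ / MonoidHom.id Lˣ

/-- `T u = σu / u`. [folklore] -/
@[simp] theorem twistEnd_apply (σ : L ≃ₐ[K] L) (u : Lˣ) : twistEnd σ u = σ • u / u := rfl

/-- The action of `Gal(L/K)` on `Lˣ`, on values. [folklore] -/
theorem coe_smul_units (g : L ≃ₐ[K] L) (u : Lˣ) : ((g • u : Lˣ) : L) = g (u : L) := rfl

/-- Neukirch's `N_G a = ∏_{i<n} a^{σ^i}` on `Lˣ`. [cite: NeukirchANT1999, Ch. IV §7 (p. 310)] -/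
noncomputable def normEnd (σ : L ≃ₐ[K] L) (n : ℕ) : Lˣ →* Lˣ :=
  ∏ i ∈ Finset.range n, MulDistribMulAction.toMonoidHom Lˣ (σ ^ i)

/-- `N u = ∏_{i<n} σ^i u`. [folklore] -/
theorem normEnd_apply (σ : L ≃ₐ[K] L) (n : ℕ) (u : Lˣ) :
    normEnd σ n u = ∏ i ∈ Finset.range n, (σ ^ i) • u := by
  simp [normEnd, MonoidHom.finsetProd_apply]

/-- `N u` on values. [folklore] -/
theorem coe_normEnd_apply (σ : L ≃ₐ[K] L) (n : ℕ) (u : Lˣ) :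
    ((normEnd σ n u : Lˣ) : L) = ∏ i ∈ Finset.range n, (σ ^ i) (u : L) := by
  rw [normEnd_apply, Units.coe_prod]
  rfl

/-- In a finite group generated by `σ`, `i ↦ σ^i`, `i < #G`, enumerates `G` once: products over
`G` are products over `range #G`. [folklore] -/
theorem prod_range_card_pow_eq_prod {G M : Type*} [Group G] [Fintype G] [CommMonoid M] {σ : G}
    (hσ : ∀ τ : G, τ ∈ Subgroup.zpowers σ) (f : G → M) :
    ∏ i ∈ Finset.range (Nat.card G), f (σ ^ i) = ∏ g, f g := by
  classical
  have ho : orderOf σ = Nat.card G := orderOf_eq_card_of_forall_mem_zpowers hσ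
  have hinj : ∀ i ∈ Finset.range (Nat.card G), ∀ j ∈ Finset.range (Nat.card G),
      σ ^ i = σ ^ j → i = j := by
    intro i hi j hj h
    rw [Finset.mem_range, ← ho] at hi hj
    exact pow_injOn_Iio_orderOf (Set.mem_Iio.mpr hi) (Set.mem_Iio.mpr hj) h
  have himg : (Finset.range (Nat.card G)).image (fun i => σ ^ i) = Finset.univ := by
    apply Finset.eq_univ_of_card
    rw [Finset.card_image_of_injOn (fun i hi j hj h => hinj i hi j hj h), Finset.card_range,
      Nat.card_eq_fintype_card]
  rw [← himg, Finset.prod_image hinj]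

section Galois

variable [FiniteDimensional K L] {σ : L ≃ₐ[K] L}

/-- For `n = #G`, `N u = N_{L/K}(u)` (viewed in `L`). [cite: NeukirchANT1999, Ch. IV §7 (p. 310)] -/
theorem coe_normEnd_eq_algebraMap_norm [IsGalois K L] (hσ : ∀ τ : L ≃ₐ[K] L, τ ∈ Subgroup.zpowers σ)
    (u : Lˣ) :
    ((normEnd σ (Nat.card (L ≃ₐ[K] L)) u : Lˣ) : L) = algebraMap K L (Algebra.norm K (u : L)) := by
  rw [coe_normEnd_apply, Algebra.norm_eq_prod_automorphisms,
    prod_range_card_pow_eq_prod hσ (fun g => g (u : L))]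

/-- `N = (Kˣ → Lˣ) ∘ N_{L/K}` as homomorphisms of `Lˣ`. [folklore] -/
theorem normEnd_eq_comp [IsGalois K L] (hσ : ∀ τ : L ≃ₐ[K] L, τ ∈ Subgroup.zpowers σ) :
    normEnd σ (Nat.card (L ≃ₐ[K] L)) =
      (unitsIncl K L).comp (Units.map (Algebra.norm K : L →* K)) := by
  ext u
  rw [coe_normEnd_eq_algebraMap_norm hσ]
  rfl

/-- `im N = N_{L/K}(Lˣ) ≤ Kˣ ≤ Lˣ`. [folklore] -/
theorem range_normEnd [IsGalois K L] (hσ : ∀ τ : L ≃ₐ[K] L, τ ∈ Subgroup.zpowers σ) :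
    (normEnd σ (Nat.card (L ≃ₐ[K] L))).range =
      ((Units.map (Algebra.norm K : L →* K)).range).map (unitsIncl K L) := by
  rw [normEnd_eq_comp hσ, MonoidHom.range_comp]

omit [FiniteDimensional K L] in
/-- An element fixed by the generator `σ` is fixed by all of `G`. [folklore] -/
theorem forall_smul_eq_of_smul_eq {α : Type*} [MulAction (L ≃ₐ[K] L) α]
    (hσ : ∀ τ : L ≃ₐ[K] L, τ ∈ Subgroup.zpowers σ) {x : α} (hx : σ • x = x) (g : L ≃ₐ[K] L) :
    g • x = x := by
  have hle : Subgroup.zpowers σ ≤ MulAction.stabilizer (L ≃ₐ[K] L) x :=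
    (Subgroup.zpowers_le (G := L ≃ₐ[K] L)).mpr hx
  exact hle (hσ g)

/-- `ker T = A^G = Kˣ`: a unit fixed by `σ` lies in `K` (Galois theory). [cite: NeukirchANT1999, Ch. IV §7 (p. 310)] -/
theorem mem_ker_twistEnd_iff [IsGalois K L] (hσ : ∀ τ : L ≃ₐ[K] L, τ ∈ Subgroup.zpowers σ) (u : Lˣ) :
    u ∈ (twistEnd σ).ker ↔ u ∈ (unitsIncl K L).range := by
  rw [MonoidHom.mem_ker, twistEnd_apply, div_eq_one]
  constructor
  · intro h
    have hfix : ∀ g : L ≃ₐ[K] L, g (u : L) = u := fun g => by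
      have := forall_smul_eq_of_smul_eq hσ h g
      exact congrArg Units.val this
    have hmem : (u : L) ∈ (⊥ : IntermediateField K L) := (IsGalois.mem_bot_iff_fixed _).mpr hfix
    obtain ⟨y, hy⟩ := IntermediateField.mem_bot.mp hmem
    have hy0 : y ≠ 0 := by
      rintro rfl
      rw [map_zero] at hy
      exact u.ne_zero hy.symm
    exact ⟨Units.mk0 y hy0, Units.ext hy⟩
  · rintro ⟨y, rfl⟩
    ext
    change σ (algebraMap K L y) = algebraMap K L y
    exact σ.commutes _

/-- `ker T = Kˣ` as subgroups of `Lˣ`. [folklore] -/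
theorem ker_twistEnd [IsGalois K L] (hσ : ∀ τ : L ≃ₐ[K] L, τ ∈ Subgroup.zpowers σ) :
    (twistEnd σ).ker = (unitsIncl K L).range :=
  Subgroup.ext (mem_ker_twistEnd_iff hσ)

/-- `σ` fixes norms: `σ • N u = N u`. [folklore] -/
theorem smul_normEnd [IsGalois K L] (hσ : ∀ τ : L ≃ₐ[K] L, τ ∈ Subgroup.zpowers σ) (u : Lˣ) :
    σ • normEnd σ (Nat.card (L ≃ₐ[K] L)) u = normEnd σ (Nat.card (L ≃ₐ[K] L)) u := by
  ext
  rw [coe_smul_units, coe_normEnd_eq_algebraMap_norm hσ, AlgEquiv.commutes]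

/-- `N (σ • u) = N u`. [folklore] -/
theorem normEnd_smul [IsGalois K L] (hσ : ∀ τ : L ≃ₐ[K] L, τ ∈ Subgroup.zpowers σ) (u : Lˣ) :
    normEnd σ (Nat.card (L ≃ₐ[K] L)) (σ • u) = normEnd σ (Nat.card (L ≃ₐ[K] L)) u := by
  ext
  rw [coe_normEnd_eq_algebraMap_norm hσ, coe_normEnd_eq_algebraMap_norm hσ, coe_smul_units,
    Algebra.norm_eq_of_algEquiv]

/-- `N ∘ T = 1`. [cite: NeukirchANT1999, Ch. IV §7 (p. 310)] -/
theorem normEnd_twistEnd [IsGalois K L] (hσ : ∀ τ : L ≃ₐ[K] L, τ ∈ Subgroup.zpowers σ) (u : Lˣ) :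
    normEnd σ (Nat.card (L ≃ₐ[K] L)) (twistEnd σ u) = 1 := by
  rw [twistEnd_apply, map_div, normEnd_smul hσ, div_self']

/-- `T ∘ N = 1`. [cite: NeukirchANT1999, Ch. IV §7 (p. 310)] -/
theorem twistEnd_normEnd [IsGalois K L] (hσ : ∀ τ : L ≃ₐ[K] L, τ ∈ Subgroup.zpowers σ) (u : Lˣ) :
    twistEnd σ (normEnd σ (Nat.card (L ≃ₐ[K] L)) u) = 1 := by
  rw [twistEnd_apply, smul_normEnd hσ, div_self']

/-! ### Hilbert 90 for cyclic extensions (Neukirch IV (3.5), from Noether's form via (3.7)) -/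

/-- The partial norms `P m = ∏_{i<m} σ^i a`. [cite: NeukirchANT1999, Ch. IV §3 Prop. (3.7) (proof)] -/
noncomputable def partialNorm (σ : L ≃ₐ[K] L) (a : Lˣ) (m : ℕ) : Lˣ :=
  ∏ i ∈ Finset.range m, (σ ^ i) • a

omit [FiniteDimensional K L] in
/-- `P 0 = 1`. [folklore] -/
@[simp] theorem partialNorm_zero (a : Lˣ) : partialNorm σ a 0 = 1 := by simp [partialNorm]

omit [FiniteDimensional K L] in
/-- `P 1 = a`. [folklore] -/
@[simp] theorem partialNorm_one (a : Lˣ) : partialNorm σ a 1 = a := by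
  rw [partialNorm, Finset.prod_range_one, pow_zero, one_smul]

omit [FiniteDimensional K L] in
/-- The cocycle identity `P (j + k) = P j · σ^j P k`. [cite: NeukirchANT1999, Ch. IV §3 Prop. (3.7) (proof)] -/
theorem partialNorm_add (a : Lˣ) (j k : ℕ) :
    partialNorm σ a (j + k) = partialNorm σ a j * (σ ^ j) • partialNorm σ a k := by
  unfold partialNorm
  rw [Finset.prod_range_add, Finset.smul_prod']
  congr 1
  refine Finset.prod_congr rfl fun i _ => ?_
  rw [pow_add, mul_smul]

omit [FiniteDimensional K L] in
/-- `P n = N a`. [folklore] -/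
theorem partialNorm_eq_normEnd (a : Lˣ) (n : ℕ) : partialNorm σ a n = normEnd σ n a := by
  rw [partialNorm, normEnd_apply]

omit [FiniteDimensional K L] in
/-- If `N a = 1` then `P` is `n`-periodic (`P (m+n) = P m · σ^m N a`). [folklore] -/
theorem partialNorm_add_mul {n : ℕ} {a : Lˣ} (ha : normEnd σ n a = 1) (m q : ℕ) :
    partialNorm σ a (m + n * q) = partialNorm σ a m := by
  induction q with
  | zero => simp
  | succ q ih =>
    rw [Nat.mul_succ, ← add_assoc, partialNorm_add, ih, partialNorm_eq_normEnd a n, ha, smul_one,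
      mul_one]

omit [FiniteDimensional K L] in
/-- … hence depends only on `m mod n`. [folklore] -/
theorem partialNorm_eq_of_modEq {n : ℕ} {a : Lˣ} (ha : normEnd σ n a = 1)
    {m m' : ℕ} (h : m ≡ m' [MOD n]) : partialNorm σ a m = partialNorm σ a m' := by
  -- reduce both to the common residue
  have key : ∀ m, partialNorm σ a m = partialNorm σ a (m % n) := fun m => by
    conv_lhs => rw [← Nat.mod_add_div m n]
    exact partialNorm_add_mul ha _ _
  rw [key m, key m', h]

/-- **Hilbert 90** (cyclic form, Neukirch IV (3.5)): if `L/K` is finite Galois with group generated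
by `σ` and `N a = ∏_{i<#G} σ^i a = 1`, then `a = σb/b` for some `b ∈ Lˣ`.  Proof as in Neukirch
IV (3.7): `σ^k ↦ P k` is a `1`-cocycle, and Noether's `H¹(G, Lˣ) = 1` (IV (3.8), Mathlib) makes it
a coboundary. [cite: NeukirchANT1999, Ch. IV §3 Thm. (3.5)] -/
theorem exists_smul_div_eq_of_normEnd_eq_one (hσ : ∀ τ : L ≃ₐ[K] L, τ ∈ Subgroup.zpowers σ)
    {a : Lˣ} (ha : normEnd σ (Nat.card (L ≃ₐ[K] L)) a = 1) : ∃ b : Lˣ, σ • b / b = a := by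
  classical
  set n := Nat.card (L ≃ₐ[K] L) with hn_def
  have ho : orderOf σ = n := orderOf_eq_card_of_forall_mem_zpowers hσ
  -- exponents
  have hex : ∀ g : L ≃ₐ[K] L, ∃ k : ℕ, σ ^ k = g := fun g =>
    (Submonoid.mem_powers_iff _ _).mp (mem_powers_iff_mem_zpowers.mpr (hσ g))
  choose e he using hex
  -- the cocycle
  set f : (L ≃ₐ[K] L) → Lˣ := fun g => partialNorm σ a (e g) with hf
  have hmod : ∀ {k k' : ℕ}, σ ^ k = σ ^ k' → k ≡ k' [MOD n] := fun h => by
    rw [← ho]; exact pow_eq_pow_iff_modEq.mp h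
  have hcocycle : groupCohomology.IsMulCocycle₁ f := by
    intro g h
    simp only [hf]
    have h1 : e (g * h) ≡ e g + e h [MOD n] := hmod (by rw [he, pow_add, he, he])
    rw [partialNorm_eq_of_modEq ha h1, partialNorm_add, he, mul_comm]
  obtain ⟨b, hb⟩ := groupCohomology.isMulCoboundary₁_of_isMulCocycle₁_of_aut_to_units f hcocycle
  refine ⟨b, ?_⟩
  rw [hb σ]
  simp only [hf]
  have h1 : e σ ≡ 1 [MOD n] := hmod (by rw [he, pow_one])
  rw [partialNorm_eq_of_modEq ha h1, partialNorm_one]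

/-- `H⁻¹(G, Lˣ) = 1` in index form: `ker N ≤ im T`. [cite: NeukirchANT1999, Ch. IV §3 Thm. (3.5)] -/
theorem ker_normEnd_le_range_twistEnd (hσ : ∀ τ : L ≃ₐ[K] L, τ ∈ Subgroup.zpowers σ) :
    (normEnd σ (Nat.card (L ≃ₐ[K] L))).ker ≤ (twistEnd σ).range := by
  intro a ha
  obtain ⟨b, hb⟩ := exists_smul_div_eq_of_normEnd_eq_one hσ ha
  exact ⟨b, hb⟩

/-- **Hilbert 90** on elements of `L`: `N_{L/K}(x) = 1` implies `x = σ(y)/y` with `y ≠ 0`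
(for every field `K`, `L/K` finite Galois with group generated by `σ`).
[cite: NeukirchANT1999, Ch. IV §3 Thm. (3.5)] -/
theorem exists_eq_div_of_norm_eq_one [IsGalois K L] (hσ : ∀ τ : L ≃ₐ[K] L, τ ∈ Subgroup.zpowers σ)
    {x : L} (hx : Algebra.norm K x = 1) : ∃ y : L, y ≠ 0 ∧ x = σ y / y := by
  have hx0 : x ≠ 0 := by
    rintro rfl
    rw [Algebra.norm_zero] at hx
    exact zero_ne_one hx
  have ha : normEnd σ (Nat.card (L ≃ₐ[K] L)) (Units.mk0 x hx0) = 1 := by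
    ext
    rw [coe_normEnd_eq_algebraMap_norm hσ, Units.val_mk0, hx, map_one, Units.val_one]
  obtain ⟨b, hb⟩ := exists_smul_div_eq_of_normEnd_eq_one hσ ha
  refine ⟨b, b.ne_zero, ?_⟩
  have := congrArg Units.val hb
  rw [Units.val_div_eq_div_val, coe_smul_units, Units.val_mk0] at this
  exact this.symm

/-! ### The reduction of `#H⁰(G, Lˣ) = #G` to a cohomologically trivial subgroup -/

omit [FiniteDimensional K L] in
/-- `N` maps a `σ`-stable subgroup into itself. [folklore] -/
theorem normEnd_mem_of_mem {V : Subgroup Lˣ} (hV : ∀ u ∈ V, σ • u ∈ V) (n : ℕ) {u : Lˣ}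
    (hu : u ∈ V) : normEnd σ n u ∈ V := by
  have key : ∀ i : ℕ, (σ ^ i) • u ∈ V := fun i => by
    induction i with
    | zero => simpa using hu
    | succ i ih => rw [pow_succ', mul_smul]; exact hV _ ih
  rw [normEnd_apply]
  exact Subgroup.prod_mem _ fun i _ => key i

omit [FiniteDimensional K L] in
/-- `T` maps a `σ`-stable subgroup into itself. [folklore] -/
theorem twistEnd_mem_of_mem {V : Subgroup Lˣ} (hV : ∀ u ∈ V, σ • u ∈ V) {u : Lˣ} (hu : u ∈ V) :
    twistEnd σ u ∈ V := by
  rw [twistEnd_apply]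
  exact V.div_mem (hV u hu) hu

omit [FiniteDimensional K L] in
/-- Every element of `Gal(L/K)` fixes `Kˣ`. [folklore] -/
theorem smul_unitsIncl (g : L ≃ₐ[K] L) (c : Kˣ) : g • unitsIncl K L c = unitsIncl K L c := by
  ext
  rw [coe_smul_units, coe_unitsIncl, AlgEquiv.commutes]

omit [FiniteDimensional K L] in
/-- `N c = c^n` for `c ∈ Kˣ`. [folklore] -/
theorem normEnd_unitsIncl (n : ℕ) (c : Kˣ) : normEnd σ n (unitsIncl K L c) = unitsIncl K L c ^ n := by
  rw [normEnd_apply, Finset.prod_congr rfl fun i _ => smul_unitsIncl (σ ^ i) c,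
    Finset.prod_const, Finset.card_range]

omit [FiniteDimensional K L] in
/-- `T c = 1` for `c ∈ Kˣ`. [folklore] -/
theorem twistEnd_unitsIncl (c : Kˣ) : twistEnd σ (unitsIncl K L c) = 1 := by
  rw [twistEnd_apply, smul_unitsIncl, div_self']

variable [IsGalois K L]

section Reduction

variable (hσ : ∀ τ : L ≃ₐ[K] L, τ ∈ Subgroup.zpowers σ) (V : Subgroup Lˣ) (c : Kˣ)
  (hV : ∀ u ∈ V, σ • u ∈ V) (hc : ∀ k : ℤ, unitsIncl K L c ^ k ∈ V → k = 0)

local notation "n" => Nat.card (L ≃ₐ[K] L)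
local notation "N" => normEnd σ (Nat.card (L ≃ₐ[K] L))
local notation "T" => twistEnd σ
local notation "Φ" => V ⊔ Subgroup.zpowers (unitsIncl K L c)

omit [FiniteDimensional K L] [IsGalois K L] in
include hV in
/-- `N Φ ⊆ Φ` for `Φ = V · c^ℤ`. [folklore] -/
theorem map_normEnd_le : (Φ).map N ≤ Φ := by
  rintro _ ⟨x, hx, rfl⟩
  obtain ⟨v, hv, z, hz, rfl⟩ := Subgroup.mem_sup.mp hx
  obtain ⟨k, rfl⟩ := Subgroup.mem_zpowers_iff.mp hz
  rw [map_mul, map_zpow, normEnd_unitsIncl, ← zpow_natCast, ← zpow_mul]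
  exact Subgroup.mul_mem _ (Subgroup.mem_sup_left (normEnd_mem_of_mem hV _ hv))
    (Subgroup.mem_sup_right (Subgroup.zpow_mem_zpowers _ _))

omit [FiniteDimensional K L] [IsGalois K L] in
include hV in
/-- `T Φ ⊆ Φ` for `Φ = V · c^ℤ`. [folklore] -/
theorem map_twistEnd_le : (Φ).map T ≤ Φ := by
  rintro _ ⟨x, hx, rfl⟩
  obtain ⟨v, hv, z, hz, rfl⟩ := Subgroup.mem_sup.mp hx
  obtain ⟨k, rfl⟩ := Subgroup.mem_zpowers_iff.mp hz
  rw [map_mul, map_zpow, twistEnd_unitsIncl, one_zpow, mul_one]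
  exact Subgroup.mem_sup_left (twistEnd_mem_of_mem hV hv)

omit [IsGalois K L] in
include hV hc in
/-- `H⁻¹` count on `Φ`: `Φ ∩ ker N ⊆ T Φ`, granted `H⁻¹(G, V) = 1`. [cite: NeukirchANT1999, Ch. V §1 Thm. (1.1) (proof)] -/
theorem inf_ker_normEnd_le_map_twistEnd (h1 : ∀ u ∈ V, N u = 1 → ∃ w ∈ V, T w = u) :
    Φ ⊓ (N).ker ≤ (Φ).map T := by
  intro x hx
  obtain ⟨hxΦ, hxN⟩ := Subgroup.mem_inf.mp hx
  rw [MonoidHom.mem_ker] at hxN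
  obtain ⟨v, hv, z, hz, rfl⟩ := Subgroup.mem_sup.mp hxΦ
  obtain ⟨k, rfl⟩ := Subgroup.mem_zpowers_iff.mp hz
  rw [map_mul, map_zpow, normEnd_unitsIncl, ← zpow_natCast, ← zpow_mul,
    mul_eq_one_iff_eq_inv] at hxN
  -- `c^{nk} = (N v)⁻¹ ∈ V` forces `k = 0`
  have hmem : unitsIncl K L c ^ ((n : ℤ) * k) ∈ V := by
    rw [← inv_mem_iff, ← hxN]
    exact normEnd_mem_of_mem hV _ hv
  have hk : k = 0 := by
    have := hc _ hmem
    have hn0 : (n : ℤ) ≠ 0 := by exact_mod_cast (Nat.card_pos (α := L ≃ₐ[K] L)).ne'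
    exact (mul_eq_zero.mp this).resolve_left hn0
  subst hk
  rw [mul_zero, zpow_zero, inv_one] at hxN
  obtain ⟨w, hw, hwv⟩ := h1 v hv hxN
  rw [zpow_zero, mul_one]
  exact ⟨w, Subgroup.mem_sup_left hw, hwv⟩

include hσ hV hc in
/-- `H⁰` count on `Φ`: `(Φ ∩ ker T : N Φ) = #G`, granted `H⁰(G, V) = 1` (`Φ ∩ ker T = N(V)·c^ℤ`,
`N Φ = N(V)·c^{nℤ}`). [cite: NeukirchANT1999, Ch. V §1 Thm. (1.1) (proof)] -/
theorem relIndex_map_normEnd_eq_card (h0 : ∀ u ∈ V, σ • u = u → ∃ w ∈ V, N w = u) :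
    ((Φ).map N).relIndex (Φ ⊓ (T).ker) = n := by
  classical
  set A : Subgroup Lˣ := Φ ⊓ (T).ker with hA
  set B : Subgroup Lˣ := (Φ).map N with hB
  have hn0 : 0 < n := Nat.card_pos
  have hBA : B ≤ A := by
    intro y hy
    refine Subgroup.mem_inf.mpr ⟨map_normEnd_le V c hV hy, ?_⟩
    obtain ⟨x, -, rfl⟩ := hy
    rw [MonoidHom.mem_ker]
    exact twistEnd_normEnd hσ x
  have hcA : ∀ i : ℤ, unitsIncl K L c ^ i ∈ A := fun i =>
    Subgroup.mem_inf.mpr ⟨Subgroup.mem_sup_right (Subgroup.zpow_mem_zpowers _ _), by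
      rw [MonoidHom.mem_ker, map_zpow, twistEnd_unitsIncl, one_zpow]⟩
  -- membership in `B` of a power of `c`
  have hcB : ∀ i : ℤ, unitsIncl K L c ^ i ∈ B ↔ (n : ℤ) ∣ i := by
    intro i
    constructor
    · rintro ⟨x, hx, hxi⟩
      obtain ⟨v, hv, z, hz, rfl⟩ := Subgroup.mem_sup.mp hx
      obtain ⟨k, rfl⟩ := Subgroup.mem_zpowers_iff.mp hz
      rw [map_mul, map_zpow, normEnd_unitsIncl, ← zpow_natCast, ← zpow_mul] at hxi
      -- `c^{i - nk} = N v ∈ V`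
      have hmem : unitsIncl K L c ^ (i - n * k) ∈ V := by
        rw [zpow_sub, ← hxi, mul_inv_cancel_right]
        exact normEnd_mem_of_mem hV _ hv
      have := hc _ hmem
      exact ⟨k, by omega⟩
    · rintro ⟨k, rfl⟩
      refine ⟨unitsIncl K L c ^ k, Subgroup.mem_sup_right (Subgroup.zpow_mem_zpowers _ _), ?_⟩
      rw [map_zpow, normEnd_unitsIncl, ← zpow_natCast, ← zpow_mul]
  -- the bijection `Fin n → A ⧸ B`
  rw [Subgroup.relIndex, Subgroup.index_eq_card]
  let ψ : Fin n → A ⧸ B.subgroupOf A := fun i => QuotientGroup.mk ⟨unitsIncl K L c ^ (i : ℤ), hcA i⟩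
  have hψ : Function.Bijective ψ := by
    constructor
    · intro i j hij
      have h := QuotientGroup.eq.mp hij
      rw [Subgroup.mem_subgroupOf, Subgroup.coe_mul, Subgroup.coe_inv, ← zpow_neg, ← zpow_add,
        hcB] at h
      apply Fin.ext
      have hi := i.2
      have hj := j.2
      have habs : |(-((i : ℕ) : ℤ) + ((j : ℕ) : ℤ))| < (n : ℤ) := abs_lt.mpr ⟨by omega, by omega⟩
      have h0 := Int.eq_zero_of_abs_lt_dvd h habs
      omega
    · intro q
      obtain ⟨⟨a, ha⟩, rfl⟩ := QuotientGroup.mk_surjective q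
      obtain ⟨haΦ, haT⟩ := Subgroup.mem_inf.mp ha
      obtain ⟨v, hv, z, hz, hvz⟩ := Subgroup.mem_sup.mp haΦ
      obtain ⟨k, rfl⟩ := Subgroup.mem_zpowers_iff.mp hz
      -- `v` is `σ`-fixed, hence a norm from `V`
      have hvfix : σ • v = v := by
        rw [MonoidHom.mem_ker, twistEnd_apply, div_eq_one, ← hvz, smul_mul', smul_zpow',
          smul_unitsIncl] at haT
        exact mul_right_cancel haT
      obtain ⟨w, hw, hwv⟩ := h0 v hv hvfix
      refine ⟨⟨(k % (n : ℤ)).toNat, ?_⟩, ?_⟩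
      · have h1 : 0 ≤ k % (n : ℤ) := Int.emod_nonneg _ (by exact_mod_cast hn0.ne')
        have h2 : k % (n : ℤ) < n := Int.emod_lt_of_pos _ (by exact_mod_cast hn0)
        omega
      · apply QuotientGroup.eq.mpr
        rw [Subgroup.mem_subgroupOf, Subgroup.coe_mul, Subgroup.coe_inv]
        change (unitsIncl K L c ^ (((k % (n : ℤ)).toNat : ℕ) : ℤ))⁻¹ * a ∈ B
        have h1 : 0 ≤ k % (n : ℤ) := Int.emod_nonneg _ (by exact_mod_cast hn0.ne')
        rw [Int.toNat_of_nonneg h1, ← hvz, ← hwv]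
        -- `c^{-(k mod n)} · N w · c^k = N (w · c^{k div n})`
        set r := k % (n : ℤ) with hr
        set s := k / (n : ℤ) with hs
        have hk : k = r + (n : ℤ) * s := (Int.emod_add_mul_ediv k n).symm
        have hsplit : unitsIncl K L c ^ k = unitsIncl K L c ^ r * unitsIncl K L c ^ ((n : ℤ) * s) := by
          rw [← zpow_add, ← hk]
        rw [hsplit, mul_left_comm (N w), inv_mul_cancel_left]
        refine ⟨w * unitsIncl K L c ^ s, Subgroup.mul_mem _ (Subgroup.mem_sup_left hw)
          (Subgroup.mem_sup_right (Subgroup.zpow_mem_zpowers _ _)), ?_⟩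
        rw [map_mul, map_zpow, normEnd_unitsIncl, ← zpow_natCast, ← zpow_mul]
  rw [← Nat.card_eq_of_bijective ψ hψ, Nat.card_eq_fintype_card, Fintype.card_fin]

include hσ hV hc in
/-- **The reduction theorem.**  Let `L/K` be finite Galois with group `G` generated by `σ`, and
suppose `V ≤ Lˣ` is `σ`-stable and cohomologically trivial — `H⁰(G, V) = 1` (every `σ`-fixed
element of `V` is `N w`, `w ∈ V`) and `H⁻¹(G, V) = 1` (every `v ∈ V` with `N v = 1` is `σw/w`,
`w ∈ V`) — and that for some `c ∈ Kˣ` no power `c^k`, `k ≠ 0`, lies in `V` while `V·c^ℤ` has finite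
index in `Lˣ`.  Then `(Kˣ : N_{L/K} Lˣ) = #G`.  (Neukirch: `h(G, Lˣ) = h(G, Vⁿ)·h(finite)·h(G, ℤ)
= [L:K]` and `H⁻¹(G, Lˣ) = 1`; here via O'Meara's Herbrand lemma for the finite-index subgroup
`Φ = V·c^ℤ`, whose two indices are `#G` and `1`, and Hilbert 90.)
[cite: NeukirchANT1999, Ch. V §1 Thm. (1.1) (proof); Ch. IV §7 Prop. (7.3)] -/
theorem index_range_norm_eq_card (h0 : ∀ u ∈ V, σ • u = u → ∃ w ∈ V, N w = u)
    (h1 : ∀ u ∈ V, N u = 1 → ∃ w ∈ V, T w = u) (hfin : (Φ).FiniteIndex) :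
    (Units.map (Algebra.norm K : L →* K)).range.index = n := by
  have hNT : ∀ g, N (T g) = 1 := normEnd_twistEnd hσ
  have hTN : ∀ g, T (N g) = 1 := twistEnd_normEnd hσ
  have hn0 : (n) ≠ 0 := (Nat.card_pos (α := L ≃ₐ[K] L)).ne'
  have hidx0 : ((Φ).map N).relIndex (Φ ⊓ (T).ker) = n :=
    relIndex_map_normEnd_eq_card hσ V c hV hc h0
  have hidx1 : ((Φ).map T).relIndex (Φ ⊓ (N).ker) = 1 :=
    Subgroup.relIndex_eq_one.mpr (inf_ker_normEnd_le_map_twistEnd V c hV hc h1)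
  obtain ⟨heq, -, -⟩ := Literature.GroupTheory.Index.herbrandLemma N T hNT hTN Φ hfin.index_ne_zero
    (map_normEnd_le V c hV) (map_twistEnd_le V c hV) (by rw [hidx0]; exact hn0)
    (by rw [hidx1]; exact one_ne_zero)
  have h90 : (T).range.relIndex (N).ker = 1 :=
    Subgroup.relIndex_eq_one.mpr (ker_normEnd_le_range_twistEnd hσ)
  rw [hidx0, hidx1, h90, mul_one, one_mul] at heq
  -- `(im N : ker T)` in `Lˣ` is `(N_{L/K} Lˣ : Kˣ)` in `Kˣ`
  rw [range_normEnd hσ, ker_twistEnd hσ, MonoidHom.range_eq_map (unitsIncl K L),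
    Subgroup.relIndex_map_map_of_injective _ _ unitsIncl_injective, Subgroup.relIndex_top_right] at heq
  exact heq

include hσ hV hc in
/-- The reduction theorem with the conclusion `(Kˣ : N_{L/K} Lˣ) = [L : K]`. [cite: NeukirchANT1999, Ch. V §1 Thm. (1.1) (proof)] -/
theorem index_range_norm_eq_finrank (h0 : ∀ u ∈ V, σ • u = u → ∃ w ∈ V, N w = u)
    (h1 : ∀ u ∈ V, N u = 1 → ∃ w ∈ V, T w = u) (hfin : (Φ).FiniteIndex) :
    (Units.map (Algebra.norm K : L →* K)).range.index = Module.finrank K L := by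
  rw [index_range_norm_eq_card hσ V c hV hc h0 h1 hfin, IsGalois.card_aut_eq_finrank]

end Reduction

end Galois

end CyclicNormIndex

end Literature.NumberTheory.GaloisRepresentations
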